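import Literature.IUT.HodgeArakelov.AbsTopMonoidsGenuineZHatPow
import Literature.IUT.HodgeArakelov.RadialExamplesEx18iiiProofs
import Literature.IUT.HodgeArakelov.AbsTopMonoidsGenuineIsometries
import HarnessLib

/-!
# [IUTchII] Ex 1.8 (iii)/(iv), Rmk 1.11.1 (i) (b): the natural `Ẑ^×`-action on `O^×(G) = 𝒪_k̄^×` is NATURAL in the
# induced isomorphisms — `Ẑ^×`-naturality of THE lifts at the genuine producer, BY RIGIDITY (proof-only)

S. Mochizuki, *Inter-universal Teichmüller theory II*, §1, Example 1.8 (iii), kurims manuscript (Dec. 2020) p. 37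
l. 48 – p. 38 l. 51: «we may think of `Γ [⊆ Ẑ^×]` as acting on the output data of the second algorithm of (∗×)
[`G ↦ (G ↷ O^×(G))`] by means of the trivial action on `G` and the natural action of `Ẑ^×` on `O^×(G)` … An
isomorphism of collections of radial data … is defined to consist of the isomorphism … induced by an isomorphism of
topological groups `Π ⥲ Π*`, together with a `Γ`-multiple of the isomorphism … `(G ↷ O^×(G)) ⥲ (G* ↷ O^×(G*))`
induced by an isomorphism of topological groups `G ⥲ G*` [so one verifies immediately that these isomorphisms are
compatible with `α_×`, `α*_×` in the evident sense]» [claim: Mochizuki2012, status: disputed] (IUTchII §1 Ex 1.8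
(iii), kurims pp.37-38); Remark 1.11.1 (i) (b) p. 50 («the natural action of `Ẑ^×` [cf. [AbsTopIII], Proposition
3.3, (ii)]»). S. Mochizuki, *Topics in absolute anabelian geometry III*, Prop. 3.2 (iv) p. 72, Prop. 3.3 (ii) p. 74
[MochizukiAbsTopIII2015]. abc-iut cell, layer L6, seat abc-iut-w6-d011 (gen 3), row «ZHAT-NAT-UNITS» — the UNITS
half of this seat's (gen 0) offer «ZHAT-NAT», completing HONEST LIMIT (α) of its `RadialExamplesEx18iiiProofs.lean`
(p429008) at the genuine producer. PROOF-ONLY (no `def` / `structure` / `instance`; nothing assumed).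

THE POINT. «Compatible in the evident sense» for the `Γ`-multiples requires that the natural `Ẑ^×`-action
`x ↦ x^u` on `O^×(G)` COMMUTE with the isomorphisms `O^×(G) ⥲ O^×(G*)` induced by `G ⥲ G*` — at the genuine producer
`genuineOfModel` (abc-iut-L6-t13, `AbsTopMonoidsGenuineProducer.lean`) these are `Units.mapEquiv` of THE lifts
`Genuine.liftM C φ` of [AbsTopIII] Prop. 3.2 (iv) (`genuineOfModel_mapOtri`, `rfl`), and the action is
abc-iut-w6-d010's `Genuine.zhatPowOunits C` (`AbsTopMonoidsGenuineZHatPow.lean`, p431139). We prove the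
commutation BY RIGIDITY, with no logarithm and no `ℤ_p`-linearity: for ANY multiplicative automorphism `T` of
`(𝒪_k̄^⊳)ˣ` that is SEMILINEAR along some self-map `φ` of `Gal(k̄/k)` (`T (σ·x) = φ(σ)·T x`), the conjugate
`T⁻¹ ∘ (x ↦ x^u) ∘ T` is again `Gal(k̄/k)`-equivariant and still raises `m`-th roots of unity to the power `χ_m(u)`;
by the UNIQUENESS half of [AbsTopIII] Prop. 3.3 (ii) (abc-iut-L6-d1's `equivariant_unitMulEquiv_eq_of_rootsOfUnity`,
packaged by abc-iut-w6-d010 as `Genuine.zhatUnitAut_unique`) it IS `x ↦ x^u`.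

PROVED here (namespace `Literature.IUT.HodgeArakelov.AbsTopMonoids.Genuine` unless stated):
* `zhatPowOunits_comm_of_semilinear` — the rigidity lemma just described (any semilinear `T`);
* `mapEquiv_liftM_zhatPowOunits`, `mapEquiv_liftM_trans_zhatPowOunits` — THE lift `liftM C φ` of every
  `φ ∈ Aut_top(Gal(k̄/k))` commutes with `x ↦ x^u` on `(𝒪_k̄^⊳)ˣ` (pointwise / as automorphisms);
* `genuineOfModel_unitsMapOtri_zhatPowOunits` (+ `_trans` form) — for every `f : G ⟶ H` in `IsoClass G_k` the induced
  isomorphism `O^×(f) = Units.mapEquiv (O^⊳(f))` of the genuine producer intertwines the `Ẑ^×`-actions on `O^×(G)`,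
  `O^×(H)`: the NATURALITY LAW of «the natural action of `Ẑ^×` on `O^×(G)`» (the units analogue of the cyclotomic
  `GaloisPairRigidityData.twist_natural`), i.e. limit (α) of p429008 CLOSED at the genuine producer;
* `genuineOfModel_munitsMapMTM_zhatPowOunits` — the same for `M^×_TM(e)`, `e : Π ⥲ Π*` (`(∗TM⊳) = id` there);
* `AbsTopMonoids.alphaTimes_postcomp_twist_eq_of_natural` — over the bare INTERFACE `A : AbsTopMonoids S` with a
  units-level `Ẑ^×`-action `zhatPow` SATISFYING the naturality law (explicit hypothesis, discharged below at the
  genuine producer): following the `Γ`-orbit `α_×` by a `Γ`-multiple `O^×(g) ≫ (· )^{γ₀}` of the induced isomorphism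
  yields exactly the `Γ`-orbit `α*_×` — SET equality of poly-isomorphisms, `Γ ⊆ Ẑ^×` any subgroup;
* `genuineOfModel_alphaTimes_twist_compatible` — at the genuine producer, BOTH sides AND the twist: conjugating the
  `Γ`-orbit `α_×` at `(Π, G)` by an isomorphism of radial data `(M^×_TM(e), O^×(g) ≫ (·)^{γ₀})`, `γ₀ ∈ Γ`, yields
  exactly the `Γ`-orbit `α*_×` at `(Π*, G*)` — the printed bracket «compatible with `α_×`, `α*_×` in the evident
  sense» with its `Γ`-factor, at `genuineOfModel`, for every subgroup `Γ ⊆ Ẑ^×`.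
HONEST LIMITS / DELTA. Everything is at the GENUINE producer `genuineOfModel` (or over the interface under the stated
naturality hypothesis); ind-topologies are not modelled. The `O^{×μ}`-level analogue (Ex. 1.8 (iv): `liftM` commutes
with the `ℤ_p^×`-powers `Genuine.zhatOxmu` on `(𝒪_k̄^⊳)ˣ⧸μ`) is abc-iut-w6-d104's `Genuine.liftM_zhatOxmu_comm`
(`AbsTopMonoidsGenuineZhatNaturality.lean`, logarithm + automatic `ℤ_p`-linearity), and the comparison
`[x^u] = zhatOxmu u [x]` is abc-iut-L6-d2's `Genuine.mk_zhatPowOunits` (`AbsTopMonoidsGenuineZHatCompare.lean`); neither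
is used or re-proved here, and neither yields the UNITS-level statement (the torsion `μ` is invisible in `O^{×μ}`),
which is what Ex. 1.8 (iii)'s `O^×(G)` with «the natural action of `Ẑ^×`» needs. HONEST FRAMING: OUR kernel
consequences of classical statements ([AbsTopIII] Prop. 3.2 (iv), 3.3 (ii), all inputs PROVED in the tree); nothing
here bears on [IUTchIII] Cor. 3.12 or takes a side; typed ≠ proved for anything downstream.
-/

namespace Literature.IUT.HodgeArakelov

open CategoryTheory
open Literature.AnabelianGeometry.AbsoluteAnabelian

namespace AbsTopMonoids

namespace Genuine

variable (C : MLFClosure.{0})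

/-! ## Rigidity ⇒ naturality: semilinear automorphisms of `(𝒪_k̄^⊳)ˣ` commute with `x ↦ x^u` -/

/-- **RIGIDITY LEMMA** ([AbsTopIII] Prop. 3.3 (ii), uniqueness half): a multiplicative automorphism `T` of
`(𝒪_k̄^⊳)ˣ` which is SEMILINEAR along some self-map `φ` of `Gal(k̄/k)` — «`y = σ(x) ⟹ T y = φ(σ)(T x)`» on underlying
elements of `k̄` — COMMUTES with the natural `Ẑ^×`-action `x ↦ x^u` (`Genuine.zhatPowOunits`). Proof: the conjugate
`T⁻¹ ∘ (·)^u ∘ T`, read on `𝒪_k̄^×`, is `Gal(k̄/k)`-equivariant and acts on `μ_m` by `ζ ↦ ζ^{χ_m(u)}`, hence equals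
`(·)^u` by `zhatUnitAut_unique`. [cite: MochizukiAbsTopIII2015, Proposition 3.3 (ii) p.74] -/
theorem zhatPowOunits_comm_of_semilinear
    (T : (nonzeroIntegers C.k C.K)ˣ ≃* (nonzeroIntegers C.k C.K)ˣ)
    (φ : (C.K ≃ₐ[C.k] C.K) → (C.K ≃ₐ[C.k] C.K))
    (hT : ∀ (σ : C.K ≃ₐ[C.k] C.K) (x y : (nonzeroIntegers C.k C.K)ˣ),
      ((y : nonzeroIntegers C.k C.K) : C.K) = σ ((x : nonzeroIntegers C.k C.K) : C.K) →
        ((T y : nonzeroIntegers C.k C.K) : C.K) = φ σ ((T x : nonzeroIntegers C.k C.K) : C.K))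
    (u : ZHatUnits) (x : (nonzeroIntegers C.k C.K)ˣ) :
    T (zhatPowOunits C u x) = zhatPowOunits C u (T x) := by
  -- `T⁻¹` is semilinear the other way round
  have hTinv : ∀ (σ : C.K ≃ₐ[C.k] C.K) (p q : (nonzeroIntegers C.k C.K)ˣ),
      ((q : nonzeroIntegers C.k C.K) : C.K) = φ σ ((p : nonzeroIntegers C.k C.K) : C.K) →
        ((T.symm q : nonzeroIntegers C.k C.K) : C.K) = σ ((T.symm p : nonzeroIntegers C.k C.K) : C.K) := by
    intro σ p q hpq
    let σM : nonzeroIntegers C.k C.K ≃* nonzeroIntegers C.k C.K :=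
      MulDistribMulAction.toMulAut (ModelMLFGaloisData.galois C.k C.K).tmPair.Pi
        (ModelMLFGaloisData.galois C.k C.K).tmPair.M σ
    let y₀ : (nonzeroIntegers C.k C.K)ˣ := Units.mapEquiv σM (T.symm p)
    have hy₀ : ((y₀ : nonzeroIntegers C.k C.K) : C.K) = σ ((T.symm p : nonzeroIntegers C.k C.K) : C.K) := rfl
    have hTy₀ : ((T y₀ : nonzeroIntegers C.k C.K) : C.K) = ((q : nonzeroIntegers C.k C.K) : C.K) := by
      rw [hT σ (T.symm p) y₀ hy₀, MulEquiv.apply_symm_apply, hpq]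
    have hq : T y₀ = q := Units.ext (Subtype.ext hTy₀)
    rw [← hq, MulEquiv.symm_apply_apply, hy₀]
  -- the conjugate `T⁻¹ ∘ (·)^u ∘ T`, read on `𝒪_k̄^× = unitSubmonoid k k̄`
  let β : unitSubmonoid C.k C.K ≃* unitSubmonoid C.k C.K :=
    ((ModelMLFGaloisData.unitsEquivUnitSubmonoid C).symm.trans
      ((T.trans (zhatPowOunits C u)).trans T.symm)).trans (ModelMLFGaloisData.unitsEquivUnitSubmonoid C)
  have hβapply : ∀ a : unitSubmonoid C.k C.K,
      ((β a : unitSubmonoid C.k C.K) : C.K) =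
        ((T.symm (zhatPowOunits C u (T ((ModelMLFGaloisData.unitsEquivUnitSubmonoid C).symm a))) :
          nonzeroIntegers C.k C.K) : C.K) := fun a => rfl
  -- (1) `β` is `Gal(k̄/k)`-equivariant
  have hβeq : UnitsGalEquivariant C β := by
    intro σ a b hab
    rw [hβapply, hβapply]
    exact hTinv σ _ _ (coe_zhatPowOunits_of_coe_eq C u (φ σ) _ _ (hT σ _ _ hab))
  -- (2) `β` raises `m`-th roots of unity to the power `χ_m(u)`
  have hβmu : ∀ (a : unitSubmonoid C.k C.K) (m : ℕ), 0 < m → (a : C.K) ^ m = 1 →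
      ((β a : unitSubmonoid C.k C.K) : C.K) = (a : C.K) ^ levelExp u m := by
    intro a m hm ha
    rw [hβapply]
    set w : (nonzeroIntegers C.k C.K)ˣ := T ((ModelMLFGaloisData.unitsEquivUnitSubmonoid C).symm a) with hw
    have ham : a ^ m = 1 := Subtype.ext (by rw [SubmonoidClass.coe_pow, ha]; rfl)
    have hw1 : w ^ m = 1 := by rw [hw, ← map_pow, ← map_pow, ham, map_one, map_one]
    have hwK : ((w : nonzeroIntegers C.k C.K) : C.K) ^ m = 1 := by
      have h := congrArg (fun v : (nonzeroIntegers C.k C.K)ˣ => ((v : nonzeroIntegers C.k C.K) : C.K)) hw1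
      simpa only [Units.val_pow_eq_pow_val, SubmonoidClass.coe_pow, Units.val_one, OneMemClass.coe_one] using h
    have hZ : zhatPowOunits C u w = w ^ levelExp u m := by
      apply Units.ext
      apply Subtype.ext
      rw [coe_zhatPowOunits_of_pow_eq_one C u w m hm hwK, Units.val_pow_eq_pow_val, SubmonoidClass.coe_pow]
    rw [hZ, map_pow, hw, MulEquiv.symm_apply_apply, Units.val_pow_eq_pow_val, SubmonoidClass.coe_pow]
    rfl
  -- (3) rigidity: `β = (·)^u`
  have hβ : β = zhatUnitAut C u := zhatUnitAut_unique C u β hβeq hβmu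
  -- (4) unwind at `a := e x`
  have h1 : ((β (ModelMLFGaloisData.unitsEquivUnitSubmonoid C x) : unitSubmonoid C.k C.K) : C.K) =
      ((zhatUnitAut C u (ModelMLFGaloisData.unitsEquivUnitSubmonoid C x) : unitSubmonoid C.k C.K) : C.K) := by
    rw [hβ]
  rw [hβapply, MulEquiv.symm_apply_apply, ← coe_zhatPowOunits] at h1
  have h2 : T.symm (zhatPowOunits C u (T x)) = zhatPowOunits C u x := Units.ext (Subtype.ext h1)
  rw [← h2, MulEquiv.apply_symm_apply]

/-! ## THE lifts commute with the `Ẑ^×`-action -/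

/-- **`Ẑ^×`-NATURALITY OF THE LIFTS ON `O^×`** ([AbsTopIII] Prop. 3.2 (iv) + 3.3 (ii)): for every topological
automorphism `φ` of `Gal(k̄/k)` and every `u ∈ Ẑ^×`, THE `φ`-equivariant lift `liftM C φ` to `𝒪_k̄^⊳` commutes, on the
units `(𝒪_k̄^⊳)ˣ`, with `x ↦ x^u`: `liftM(φ)(x^u) = (liftM(φ)(x))^u`. [cite: MochizukiAbsTopIII2015, Proposition 3.3 (ii) p.74] -/
theorem mapEquiv_liftM_zhatPowOunits
    (φ : (ModelMLFGaloisData.galois C.k C.K).tmPair.Pi ≃ₜ* (ModelMLFGaloisData.galois C.k C.K).tmPair.Pi)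
    (u : ZHatUnits) (x : (nonzeroIntegers C.k C.K)ˣ) :
    Units.mapEquiv (liftM C φ) (zhatPowOunits C u x) = zhatPowOunits C u (Units.mapEquiv (liftM C φ) x) := by
  refine zhatPowOunits_comm_of_semilinear C (Units.mapEquiv (liftM C φ)) (fun σ => φ σ) ?_ u x
  intro σ a b hab
  have hb : (b : nonzeroIntegers C.k C.K) =
      (show (ModelMLFGaloisData.galois C.k C.K).tmPair.Pi from σ) • (a : nonzeroIntegers C.k C.K) :=
    Subtype.ext hab
  have h := liftM_spec C φ (show (ModelMLFGaloisData.galois C.k C.K).tmPair.Pi from σ)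
    (a : nonzeroIntegers C.k C.K)
  rw [← hb] at h
  exact congrArg (fun z : nonzeroIntegers C.k C.K => (z : C.K)) h

/-- The same as an equality of automorphisms of `(𝒪_k̄^⊳)ˣ`: `(·)^u ≫ liftM(φ) = liftM(φ) ≫ (·)^u`.
[cite: MochizukiAbsTopIII2015, Proposition 3.3 (ii) p.74] -/
theorem mapEquiv_liftM_trans_zhatPowOunits
    (φ : (ModelMLFGaloisData.galois C.k C.K).tmPair.Pi ≃ₜ* (ModelMLFGaloisData.galois C.k C.K).tmPair.Pi)
    (u : ZHatUnits) :
    (zhatPowOunits C u).trans (Units.mapEquiv (liftM C φ)) =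
      (Units.mapEquiv (liftM C φ)).trans (zhatPowOunits C u) :=
  MulEquiv.ext fun x => mapEquiv_liftM_zhatPowOunits C φ u x

variable (S : ThetaSetting.{0}) (ε : S.Gk ≃ₜ* (ModelMLFGaloisData.galois C.k C.K).tmPair.Pi)
  (hΔ : ∀ f : S.PiX ≃ₜ* S.PiX, S.DeltaX.map f.toMulEquiv.toMonoidHom = S.DeltaX)
  (hq : Nonempty (TopGroup.quot S.PiX S.DeltaX ≃ₜ* S.Gk))

/-- **IUTchII:Ex1.8(iii)** (kurims p. 38 ll. 1–3 «the natural action of `Ẑ^×` on `O^×(G)`», ll. 34–42 «a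
`Γ`-multiple of the isomorphism … induced by … `G ⥲ G*` [… compatible …]») — **the NATURALITY LAW at the genuine
producer**: for every `f : G ⟶ H` in `IsoClass G_k`, the induced isomorphism of units `O^×(f)` intertwines the
`Ẑ^×`-actions `x ↦ x^u` on `O^×(G)` and `O^×(H)` (`O^⊳(f)` is THE lift of the induced automorphism of `Gal(k̄/k)`,
`genuineOfModel_mapOtri`). PROVED. [claim: Mochizuki2012, status: disputed] (IUTchII §1 Ex 1.8 (iii), kurims p.38) -/
theorem genuineOfModel_unitsMapOtri_zhatPowOunits {G H : IsoClass S.Gk} (f : G ⟶ H) (u : ZHatUnits)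
    (x : (genuineOfModel S C ε hΔ hq).Ounits G) :
    Units.mapEquiv ((genuineOfModel S C ε hΔ hq).mapOtri f) (zhatPowOunits C u x) =
      zhatPowOunits C u (Units.mapEquiv ((genuineOfModel S C ε hΔ hq).mapOtri f) x) :=
  mapEquiv_liftM_zhatPowOunits C (phiOf C ε f) u x

/-- **IUTchII:Ex1.8(iii)** (kurims p. 38), the naturality law as an equality of isomorphisms
`O^×(G) ⥲ O^×(H)`: `(·)^u ≫ O^×(f) = O^×(f) ≫ (·)^u`. PROVED.
[claim: Mochizuki2012, status: disputed] (IUTchII §1 Ex 1.8 (iii), kurims p.38) -/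
theorem genuineOfModel_unitsMapOtri_trans_zhatPowOunits {G H : IsoClass S.Gk} (f : G ⟶ H) (u : ZHatUnits) :
    (zhatPowOunits C u).trans (Units.mapEquiv ((genuineOfModel S C ε hΔ hq).mapOtri f)) =
      (Units.mapEquiv ((genuineOfModel S C ε hΔ hq).mapOtri f)).trans (zhatPowOunits C u) :=
  MulEquiv.ext fun x => genuineOfModel_unitsMapOtri_zhatPowOunits C S ε hΔ hq f u x

/-- **IUTchII:Ex1.8(iii)** (kurims p. 38 ll. 19–34 «the isomorphism … `(Π ↷ M^×_TM(Π)) ⥲ (Π* ↷ M^×_TM(Π*))`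
induced by … `Π ⥲ Π*`»): at the genuine producer (where `M_TM(Π) = 𝒪_k̄^⊳` and `M_TM(e)` is THE lift of the
automorphism of `Gal(k̄/k)` induced by `e̅ : Π/Δ ⥲ Π*/Δ*`) the induced isomorphism of units `M^×_TM(e)` also
commutes with `x ↦ x^u`. PROVED. [claim: Mochizuki2012, status: disputed] (IUTchII §1 Ex 1.8 (iii), kurims p.38) -/
theorem genuineOfModel_munitsMapMTM_zhatPowOunits {P Q : IsoClass S.PiX} (e : P ⟶ Q) (u : ZHatUnits)
    (m : ((genuineOfModel S C ε hΔ hq).MTM P)ˣ) :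
    Units.mapEquiv ((genuineOfModel S C ε hΔ hq).mapMTM e) (zhatPowOunits C u m) =
      zhatPowOunits C u (Units.mapEquiv ((genuineOfModel S C ε hΔ hq).mapMTM e) m) :=
  mapEquiv_liftM_zhatPowOunits C (phiOf C ε (qMap hΔ hq e)) u m

end Genuine

/-! ## «compatible with `α_×`, `α*_×` in the evident sense» — WITH the `Γ`-twist -/

section Interface

universe u

variable {S : ThetaSetting.{u}} (A : AbsTopMonoids S)

/-- **IUTchII:Ex1.8(iii)** (kurims p. 38 ll. 12–19 «`α_×` … the `Γ`-orbit of the poly-isomorphism `α_⊳|_×`»,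
ll. 34–42 «a `Γ`-multiple of the isomorphism … induced by … `G ⥲ G*` [so one verifies immediately that these
isomorphisms are compatible with `α_×`, `α*_×` in the evident sense]»), `G`-side, OVER THE INTERFACE, for a
units-level `Ẑ^×`-action `zhatPow` that SATISFIES THE NATURALITY LAW `O^×(g)(x^u) = (O^×(g)(x))^u` (explicit
hypothesis `hnat`; discharged at the genuine producer by `Genuine.genuineOfModel_unitsMapOtri_zhatPowOunits`):
following the `Γ`-orbit `α_× = {α_⊳|_×,φ ≫ (·)^γ}` at `(Π, G)` by the `Γ`-multiple `O^×(g) ≫ (·)^{γ₀}` (`γ₀ ∈ Γ`) of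
the isomorphism induced by `g : G ⥲ G*` yields EXACTLY the `Γ`-orbit `α*_×` at `(Π, G*)` — equality of SETS of
isomorphisms `M^×_TM(Π) ⥲ O^×(G*)`, for every subgroup `Γ ⊆ Ẑ^×`. PROVED.
[claim: Mochizuki2012, status: disputed] (IUTchII §1 Ex 1.8 (iii), kurims p.38) -/
theorem alphaTimes_postcomp_twist_eq_of_natural
    (zhatPow : ∀ G : IsoClass S.Gk, ZHatUnits →* MulAut (A.Ounits G))
    (hnat : ∀ {G G' : IsoClass S.Gk} (g : G ⟶ G') (u : ZHatUnits) (x : A.Ounits G),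
      Units.mapEquiv (A.mapOtri g) (zhatPow G u x) = zhatPow G' u (Units.mapEquiv (A.mapOtri g) x))
    (Γ : Subgroup ZHatUnits) (P : IsoClass S.PiX) {G G' : IsoClass S.Gk} (g : G ⟶ G') (γ₀ : Γ) :
    Set.range (fun φγ : (A.quotObj P ⟶ G) × Γ =>
        ((Units.mapEquiv ((A.tauto P).trans (A.mapOtri φγ.1))).trans (zhatPow G (φγ.2 : ZHatUnits))).trans
          ((Units.mapEquiv (A.mapOtri g)).trans (zhatPow G' (γ₀ : ZHatUnits)))) =
      Set.range (fun ψγ : (A.quotObj P ⟶ G') × Γ =>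
        (Units.mapEquiv ((A.tauto P).trans (A.mapOtri ψγ.1))).trans (zhatPow G' (ψγ.2 : ZHatUnits))) := by
  -- moving the twist past `O^×(g)` (naturality) and composing the two twists (`zhatPow G'` is a homomorphism)
  have key : ∀ (φ : A.quotObj P ⟶ G) (γ : Γ),
      ((Units.mapEquiv ((A.tauto P).trans (A.mapOtri φ))).trans (zhatPow G (γ : ZHatUnits))).trans
          ((Units.mapEquiv (A.mapOtri g)).trans (zhatPow G' (γ₀ : ZHatUnits))) =
        (Units.mapEquiv ((A.tauto P).trans (A.mapOtri (φ ≫ g)))).trans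
          (zhatPow G' ((γ₀ * γ : Γ) : ZHatUnits)) := by
    intro φ γ
    apply MulEquiv.ext
    intro m
    rw [← A.alphaTimesRep_trans_unitsMapEquiv P φ g]
    simp only [MulEquiv.trans_apply]
    rw [hnat g, Subgroup.coe_mul, map_mul, MulAut.mul_apply]
  ext T
  constructor
  · rintro ⟨⟨φ, γ⟩, rfl⟩
    exact ⟨⟨φ ≫ g, γ₀ * γ⟩, (key φ γ).symm⟩
  · rintro ⟨⟨ψ, γ'⟩, rfl⟩
    refine ⟨⟨ψ ≫ Groupoid.inv g, γ₀⁻¹ * γ'⟩, ?_⟩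
    change ((Units.mapEquiv ((A.tauto P).trans (A.mapOtri (ψ ≫ Groupoid.inv g)))).trans
        (zhatPow G ((γ₀⁻¹ * γ' : Γ) : ZHatUnits))).trans
          ((Units.mapEquiv (A.mapOtri g)).trans (zhatPow G' (γ₀ : ZHatUnits))) = _
    rw [key, Category.assoc, Groupoid.inv_comp, Category.comp_id, mul_inv_cancel_left]

end Interface

section GenuineTwist

open Genuine
open Literature.AnabelianGeometry.AbsoluteAnabelian

variable (S₀ : ThetaSetting.{0}) (C : MLFClosure.{0})
  (ε : S₀.Gk ≃ₜ* (ModelMLFGaloisData.galois C.k C.K).tmPair.Pi)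
  (hΔ : ∀ f : S₀.PiX ≃ₜ* S₀.PiX, S₀.DeltaX.map f.toMulEquiv.toMonoidHom = S₀.DeltaX)
  (hq : Nonempty (TopGroup.quot S₀.PiX S₀.DeltaX ≃ₜ* S₀.Gk))

/-- **IUTchII:Ex1.8(iii)** (kurims p. 38 ll. 34–42), `G`-side WITH the `Γ`-twist at the GENUINE producer, the
naturality hypothesis DISCHARGED: following the `Γ`-orbit `α_×` at `(Π, G)` by a `Γ`-multiple `O^×(g) ≫ (·)^{γ₀}` of
the induced isomorphism yields exactly the `Γ`-orbit `α*_×` at `(Π, G*)`. PROVED.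
[claim: Mochizuki2012, status: disputed] (IUTchII §1 Ex 1.8 (iii), kurims p.38) -/
theorem genuineOfModel_alphaTimes_postcomp_twist_eq (Γ : Subgroup ZHatUnits) (P : IsoClass S₀.PiX)
    {G G' : IsoClass S₀.Gk} (g : G ⟶ G') (γ₀ : Γ) :
    Set.range (fun φγ : ((genuineOfModel S₀ C ε hΔ hq).quotObj P ⟶ G) × Γ =>
        ((Units.mapEquiv (((genuineOfModel S₀ C ε hΔ hq).tauto P).trans
          ((genuineOfModel S₀ C ε hΔ hq).mapOtri φγ.1))).trans (zhatPowOunits C (φγ.2 : ZHatUnits))).trans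
          ((Units.mapEquiv ((genuineOfModel S₀ C ε hΔ hq).mapOtri g)).trans (zhatPowOunits C (γ₀ : ZHatUnits)))) =
      Set.range (fun ψγ : ((genuineOfModel S₀ C ε hΔ hq).quotObj P ⟶ G') × Γ =>
        (Units.mapEquiv (((genuineOfModel S₀ C ε hΔ hq).tauto P).trans
          ((genuineOfModel S₀ C ε hΔ hq).mapOtri ψγ.1))).trans (zhatPowOunits C (ψγ.2 : ZHatUnits))) :=
  (genuineOfModel S₀ C ε hΔ hq).alphaTimes_postcomp_twist_eq_of_natural (fun _ => zhatPowOunits C)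
    (fun g u x => genuineOfModel_unitsMapOtri_zhatPowOunits C S₀ ε hΔ hq g u x) Γ P g γ₀

/-- **IUTchII:Ex1.8(iii)** (kurims p. 38 ll. 19–42 «[so one verifies immediately that these isomorphisms are
compatible with `α_×`, `α*_×` in the evident sense]») at the GENUINE producer, BOTH sides AND the `Γ`-twist, as
poly-isomorphisms: for an isomorphism of radial data with components `M^×_TM(e)` (induced by `e : Π ⥲ Π*`) and the
`Γ`-multiple `O^×(g) ≫ (·)^{γ₀}` (`γ₀ ∈ Γ`) of the isomorphism induced by `g : G ⥲ G*`, conjugating the `Γ`-orbit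
`α_× = {α_⊳|_×,φ ≫ (·)^γ : φ : Π/Δ ⥲ G, γ ∈ Γ}` at `(Π, G)` — `M^×_TM(e)⁻¹`, then a member, then the `Γ`-multiple —
yields EXACTLY the `Γ`-orbit `α*_×` at `(Π*, G*)` (equality of SETS of isomorphisms `M^×_TM(Π*) ⥲ O^×(G*)`), for
every subgroup `Γ ⊆ Ẑ^×`. This is `genuineOfModel_alphaTimes_compatible` (p429008, untwisted) with its `Γ`-factor
restored — limit (α) of that file closed at the genuine producer. PROVED.
[claim: Mochizuki2012, status: disputed] (IUTchII §1 Ex 1.8 (iii), kurims p.38) -/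
theorem genuineOfModel_alphaTimes_twist_compatible (Γ : Subgroup ZHatUnits) {P Q : IsoClass S₀.PiX}
    (e : P ⟶ Q) {G G' : IsoClass S₀.Gk} (g : G ⟶ G') (γ₀ : Γ) :
    Set.range (fun φγ : ((genuineOfModel S₀ C ε hΔ hq).quotObj P ⟶ G) × Γ =>
        ((Units.mapEquiv ((genuineOfModel S₀ C ε hΔ hq).mapMTM e)).symm.trans
          ((Units.mapEquiv (((genuineOfModel S₀ C ε hΔ hq).tauto P).trans
            ((genuineOfModel S₀ C ε hΔ hq).mapOtri φγ.1))).trans (zhatPowOunits C (φγ.2 : ZHatUnits)))).trans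
          ((Units.mapEquiv ((genuineOfModel S₀ C ε hΔ hq).mapOtri g)).trans (zhatPowOunits C (γ₀ : ZHatUnits)))) =
      Set.range (fun ψγ : ((genuineOfModel S₀ C ε hΔ hq).quotObj Q ⟶ G') × Γ =>
        (Units.mapEquiv (((genuineOfModel S₀ C ε hΔ hq).tauto Q).trans
          ((genuineOfModel S₀ C ε hΔ hq).mapOtri ψγ.1))).trans (zhatPowOunits C (ψγ.2 : ZHatUnits))) := by
  -- one member at a time: `M^×(e)⁻¹ ≫ α_⊳|_×,φ ≫ (·)^γ ≫ O^×(g) ≫ (·)^{γ₀} = α*_⊳|_×,ψ ≫ (·)^{γ₀γ}` with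
  -- `ψ := (e̅⁻¹ ≫ φ) ≫ g` (naturality + the untwisted conjugation `genuineOfModel_conj_alphaTimesRep`)
  have key : ∀ (φ : (genuineOfModel S₀ C ε hΔ hq).quotObj P ⟶ G) (γ : Γ),
      ((Units.mapEquiv ((genuineOfModel S₀ C ε hΔ hq).mapMTM e)).symm.trans
          ((Units.mapEquiv (((genuineOfModel S₀ C ε hΔ hq).tauto P).trans
            ((genuineOfModel S₀ C ε hΔ hq).mapOtri φ))).trans (zhatPowOunits C (γ : ZHatUnits)))).trans
          ((Units.mapEquiv ((genuineOfModel S₀ C ε hΔ hq).mapOtri g)).trans (zhatPowOunits C (γ₀ : ZHatUnits))) =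
        (Units.mapEquiv (((genuineOfModel S₀ C ε hΔ hq).tauto Q).trans
          ((genuineOfModel S₀ C ε hΔ hq).mapOtri
            ((Groupoid.inv ((genuineOfModel S₀ C ε hΔ hq).quotMap e) ≫ φ) ≫ g)))).trans
          (zhatPowOunits C ((γ₀ * γ : Γ) : ZHatUnits)) := by
    intro φ γ
    apply MulEquiv.ext
    intro m
    -- (no `simp`/`rw` under compositions typed across `O^×(G*) = (𝒪_k̄^⊳)ˣ`: chain the pointwise identities)
    have h₀ := MulEquiv.congr_fun (genuineOfModel_conj_alphaTimesRep S₀ C ε hΔ hq e g φ) m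
    have h₁ := genuineOfModel_unitsMapOtri_zhatPowOunits C S₀ ε hΔ hq g (γ : ZHatUnits)
      (Units.mapEquiv (((genuineOfModel S₀ C ε hΔ hq).tauto P).trans ((genuineOfModel S₀ C ε hΔ hq).mapOtri φ))
        ((Units.mapEquiv ((genuineOfModel S₀ C ε hΔ hq).mapMTM e)).symm m))
    have h₂ : ∀ z : (nonzeroIntegers C.k C.K)ˣ,
        zhatPowOunits C (γ₀ : ZHatUnits) (zhatPowOunits C (γ : ZHatUnits) z) =
          zhatPowOunits C ((γ₀ * γ : Γ) : ZHatUnits) z := by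
      intro z
      rw [Subgroup.coe_mul, map_mul, MulAut.mul_apply]
    exact (congrArg (zhatPowOunits C (γ₀ : ZHatUnits)) h₁).trans
      ((h₂ _).trans (congrArg (zhatPowOunits C ((γ₀ * γ : Γ) : ZHatUnits)) h₀))
  ext T
  constructor
  · rintro ⟨⟨φ, γ⟩, rfl⟩
    exact ⟨⟨(Groupoid.inv ((genuineOfModel S₀ C ε hΔ hq).quotMap e) ≫ φ) ≫ g, γ₀ * γ⟩, (key φ γ).symm⟩
  · rintro ⟨⟨ψ, γ'⟩, rfl⟩
    refine ⟨⟨(genuineOfModel S₀ C ε hΔ hq).quotMap e ≫ (ψ ≫ Groupoid.inv g), γ₀⁻¹ * γ'⟩, ?_⟩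
    have hidx : (Groupoid.inv ((genuineOfModel S₀ C ε hΔ hq).quotMap e) ≫
        ((genuineOfModel S₀ C ε hΔ hq).quotMap e ≫ (ψ ≫ Groupoid.inv g))) ≫ g = ψ := by
      rw [← Category.assoc (Groupoid.inv _) _ _, Groupoid.inv_comp, Category.id_comp, Category.assoc,
        Groupoid.inv_comp, Category.comp_id]
    change ((Units.mapEquiv ((genuineOfModel S₀ C ε hΔ hq).mapMTM e)).symm.trans
        ((Units.mapEquiv (((genuineOfModel S₀ C ε hΔ hq).tauto P).trans
          ((genuineOfModel S₀ C ε hΔ hq).mapOtri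
            ((genuineOfModel S₀ C ε hΔ hq).quotMap e ≫ (ψ ≫ Groupoid.inv g))))).trans
          (zhatPowOunits C ((γ₀⁻¹ * γ' : Γ) : ZHatUnits)))).trans
        ((Units.mapEquiv ((genuineOfModel S₀ C ε hΔ hq).mapOtri g)).trans (zhatPowOunits C (γ₀ : ZHatUnits))) = _
    rw [key, hidx, mul_inv_cancel_left]

end GenuineTwist

end AbsTopMonoids

end Literature.IUT.HodgeArakelov

/-! ## v2 (append-only): the same at the FULLY GENUINE producer `genuineOfModelIsm` (abc-iut-L6-d2, p427597)

`genuineOfModelIsm … = (genuineOfModel …).withIsometries …` changes only the `Ism`-side data, so `O^⊳`, `O^⊳(f)`, `M_TM`,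
`M_TM(e)`, `(∗TM⊳)`, `Π/Δ` are those of `genuineOfModel` DEFINITIONALLY; the theorems above hold verbatim at the producer
where `rmk1111_b_genuineOfModelIsm` / `rmk181_genuineOfModelIsm` live (proofs: `rfl`-transport of the above). -/

namespace Literature.IUT.HodgeArakelov.AbsTopMonoids

open CategoryTheory Literature.AnabelianGeometry.AbsoluteAnabelian Genuine

variable (S₀ : ThetaSetting.{0}) (C : MLFClosure.{0})
  (ε : S₀.Gk ≃ₜ* (ModelMLFGaloisData.galois C.k C.K).tmPair.Pi)
  (hΔ : ∀ f : S₀.PiX ≃ₜ* S₀.PiX, S₀.DeltaX.map f.toMulEquiv.toMonoidHom = S₀.DeltaX)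
  (hq : Nonempty (TopGroup.quot S₀.PiX S₀.DeltaX ≃ₜ* S₀.Gk))

/-- **IUTchII:Ex1.8(iii)** (kurims p. 38 ll. 1–3, 34–42), the NATURALITY LAW at `genuineOfModelIsm`: `O^×(f)`
intertwines `x ↦ x^u` for every `f : G ⟶ H`. PROVED. [claim: Mochizuki2012, status: disputed] (IUTchII §1 Ex 1.8 (iii), kurims p.38) -/
theorem genuineOfModelIsm_unitsMapOtri_zhatPowOunits {G H : IsoClass S₀.Gk} (f : G ⟶ H) (u : ZHatUnits)
    (x : (genuineOfModelIsm S₀ C ε hΔ hq).Ounits G) :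
    Units.mapEquiv ((genuineOfModelIsm S₀ C ε hΔ hq).mapOtri f) (zhatPowOunits C u x) =
      zhatPowOunits C u (Units.mapEquiv ((genuineOfModelIsm S₀ C ε hΔ hq).mapOtri f) x) :=
  genuineOfModel_unitsMapOtri_zhatPowOunits C S₀ ε hΔ hq f u x

/-- **IUTchII:Ex1.8(iii)** (kurims p. 38 ll. 19–34) at `genuineOfModelIsm`: `M^×_TM(e)` commutes with `x ↦ x^u`.
PROVED. [claim: Mochizuki2012, status: disputed] (IUTchII §1 Ex 1.8 (iii), kurims p.38) -/
theorem genuineOfModelIsm_munitsMapMTM_zhatPowOunits {P Q : IsoClass S₀.PiX} (e : P ⟶ Q) (u : ZHatUnits)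
    (m : ((genuineOfModelIsm S₀ C ε hΔ hq).MTM P)ˣ) :
    Units.mapEquiv ((genuineOfModelIsm S₀ C ε hΔ hq).mapMTM e) (zhatPowOunits C u m) =
      zhatPowOunits C u (Units.mapEquiv ((genuineOfModelIsm S₀ C ε hΔ hq).mapMTM e) m) :=
  genuineOfModel_munitsMapMTM_zhatPowOunits C S₀ ε hΔ hq e u m

/-- **IUTchII:Ex1.8(iii)** (kurims p. 38 ll. 19–42 «compatible with `α_×`, `α*_×` in the evident sense») at
`genuineOfModelIsm`, BOTH sides AND the `Γ`-twist: `M^×_TM(e)⁻¹ ≫ α_× ≫ (O^×(g) ≫ (·)^{γ₀}) = α*_×` as SETS of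
isomorphisms `M^×_TM(Π*) ⥲ O^×(G*)`, every subgroup `Γ ⊆ Ẑ^×`, `γ₀ ∈ Γ`. PROVED.
[claim: Mochizuki2012, status: disputed] (IUTchII §1 Ex 1.8 (iii), kurims p.38) -/
theorem genuineOfModelIsm_alphaTimes_twist_compatible (Γ : Subgroup ZHatUnits) {P Q : IsoClass S₀.PiX}
    (e : P ⟶ Q) {G G' : IsoClass S₀.Gk} (g : G ⟶ G') (γ₀ : Γ) :
    Set.range (fun φγ : ((genuineOfModelIsm S₀ C ε hΔ hq).quotObj P ⟶ G) × Γ =>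
        ((Units.mapEquiv ((genuineOfModelIsm S₀ C ε hΔ hq).mapMTM e)).symm.trans
          ((Units.mapEquiv (((genuineOfModelIsm S₀ C ε hΔ hq).tauto P).trans
            ((genuineOfModelIsm S₀ C ε hΔ hq).mapOtri φγ.1))).trans (zhatPowOunits C (φγ.2 : ZHatUnits)))).trans
          ((Units.mapEquiv ((genuineOfModelIsm S₀ C ε hΔ hq).mapOtri g)).trans
            (zhatPowOunits C (γ₀ : ZHatUnits)))) =
      Set.range (fun ψγ : ((genuineOfModelIsm S₀ C ε hΔ hq).quotObj Q ⟶ G') × Γ =>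
        (Units.mapEquiv (((genuineOfModelIsm S₀ C ε hΔ hq).tauto Q).trans
          ((genuineOfModelIsm S₀ C ε hΔ hq).mapOtri ψγ.1))).trans (zhatPowOunits C (ψγ.2 : ZHatUnits))) :=
  genuineOfModel_alphaTimes_twist_compatible S₀ C ε hΔ hq Γ e g γ₀

end Literature.IUT.HodgeArakelov.AbsTopMonoids
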